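import Mathlib
import Summits.NavierStokesRegularity.NavierStokesRegularity.Theorems.ScenarioCensusPeriodicSlabTools
import Literature.Analysis.FluidPDE.SteadyHelicalLiouville
import Literature.Analysis.FluidPDE.AxisymmetricVorticityTransport
import HarnessLib

/-!
# Census row S6 (bounded helical steady flows): the helical flux lemma — the radial velocity has
# zero mean over every vertical period

Support file for the scenario census of `NavierStokesRegularity` (cell `pub/ns-census`, block S,
row S6 = Han–Wang–Xie, arXiv:2312.10382 = Sci. China Math. 2025, Thm 1.1; tree FACT
`Literature.Analysis.FluidPDE.HanWangXie2023_helical_liouville`). Display (A117) of the printed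
proof (§3, proof of Lemma 3.1): for a divergence-free helically symmetric field,
"`∂_r ∫₀¹ r u^r dz = −∫₀¹ ∂_θ u^θ + ∂_z(r u^z) dz = −∫₀¹ κ ∂_z u^θ + ∂_z(r u^z) dz = 0`. This implies
`∫₀¹ r u^r dz = 0`" — the radial velocity has ZERO MEAN over every vertical period, which is what
makes the Poincaré inequality (A122) for `u^r` available. Here is that statement in Cartesian
vocabulary, `r u^r(x) = ⟪x_h, u(x)⟫` (`x_h = horizPart x`):

* `helical_radial_verticalMean_eq_zero` — for `U ∈ C¹` with bounded derivative, divergence free,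
  axially `L`-periodic and helically symmetric of pitch `κ` (`IsHelicallySymmetric κ U`):
  `∫₀ᴸ ⟪x_h, U(x + s e₃)⟫ ds = 0` for every `x`.

Proof (no cylindrical coordinates): the vertical period integral `g(x) = ∫₀ᴸ U(x + s e₃) ds` is
`C¹` (`hasFDerivAt_verticalIntegral`), invariant under axial translations, divergence free, and
AXISYMMETRIC (screw motions act on vertical lines as rotations up to an axial shift, which the
period integral does not see: `verticalIntegral_rotZ`); for such a field the radial flux
`h(x) = ⟪x_h, g(x)⟫` satisfies `Dh(x)[x_h] = r² div g = 0` (infinitesimal axisymmetry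
`Dg(x)[Jx] = J g(x)`, `Literature.Analysis.FluidPDE.IsAxisymmetric.fderiv_rotGen`), so `h` is
constant along horizontal rays and vanishes on the axis, hence everywhere.

No summit statement and no census row is proved in this file.

## References

* J. Han, Y. Wang, C. Xie, arXiv:2312.10382 (2023), §2 Lemma 2.2 (helical identities) and §3,
  (A117)–(A118). [HanWangXie2023]
-/

-- the summit and its single problem share the name (D-0017 nested layout)
set_option linter.dupNamespace false

noncomputable section

open MeasureTheory Set Function Filter
open scoped Topology InnerProductSpace RealInnerProductSpace

namespace Summit.NavierStokesRegularity.NavierStokesRegularity.Theorems.ScenarioCensus.HelicalSlab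

open Literature.Analysis Literature.Analysis.FluidPDE
open Summit.NavierStokesRegularity.NavierStokesRegularity.Theorems.ScenarioCensus.PeriodicSlab

/-! ### Screw motions act on vertical lines -/

/-- Rotations about the axis commute with axial translations: `R_θ(x + c e₃) = R_θ x + c e₃`. -/
theorem rotZ_add_smul_eZ (θ c : ℝ) (x : EuclideanSpace ℝ (Fin 3)) :
    rotZ θ (x + c • eZ) = rotZ θ x + c • eZ := by
  ext i
  fin_cases i <;> simp [rotZ, eZ]

/-- A helically symmetric field on the vertical line through `R_θ x`:
`U(R_θ x + s e₃) = R_θ U(x + (s − κθ) e₃)`. -/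
theorem apply_rotZ_add_smul_eZ_of_isHelicallySymmetric {κ : ℝ}
    {U : EuclideanSpace ℝ (Fin 3) → EuclideanSpace ℝ (Fin 3)} (hsym : IsHelicallySymmetric κ U)
    (θ s : ℝ) (x : EuclideanSpace ℝ (Fin 3)) :
    U (rotZ θ x + s • eZ) = rotZ θ (U (x + (s - κ * θ) • eZ)) := by
  have h := hsym θ (x + (s - κ * θ) • eZ)
  rw [rotZ_add_smul_eZ, add_assoc, ← add_smul, show s - κ * θ + κ * θ = s by ring] at h
  exact h

/-! ### The vertical period integral `g(x) = ∫₀ᴸ U(x + s e₃) ds` -/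

/-- The vertical period integral of an axially `L`-periodic continuous field does not depend on
the starting height: `∫₀ᴸ U(x + (t + s) e₃) ds = ∫₀ᴸ U(x + s e₃) ds`. -/
theorem verticalIntegral_shift {F : Type*} [NormedAddCommGroup F] [NormedSpace ℝ F] {L : ℝ}
    {U : EuclideanSpace ℝ (Fin 3) → F} (hper : IsAxiallyPeriodic L U)
    (x : EuclideanSpace ℝ (Fin 3)) (t : ℝ) :
    ∫ s in (0 : ℝ)..L, U (x + (t + s) • eZ) = ∫ s in (0 : ℝ)..L, U (x + s • eZ) := by
  have hp : Function.Periodic (fun σ : ℝ => U (x + σ • eZ)) L := fun σ => by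
    show U (x + (σ + L) • eZ) = U (x + σ • eZ)
    rw [add_smul, ← add_assoc]
    exact isAxiallyPeriodic_add_smul_eZ hper (x + σ • eZ)
  have h1 : ∫ s in (0 : ℝ)..L, U (x + (t + s) • eZ) = ∫ s in t..t + L, U (x + s • eZ) := by
    rw [show (fun s : ℝ => U (x + (t + s) • eZ)) = fun s : ℝ => (fun σ : ℝ => U (x + σ • eZ)) (t + s)
      from rfl, intervalIntegral.integral_comp_add_left (fun σ : ℝ => U (x + σ • eZ)) t]
    simp
  rw [h1, hp.intervalIntegral_add_eq t 0, zero_add]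

/-- The vertical period integral is invariant under axial translations. -/
theorem verticalIntegral_add_smul_eZ {F : Type*} [NormedAddCommGroup F] [NormedSpace ℝ F] {L : ℝ}
    {U : EuclideanSpace ℝ (Fin 3) → F} (hper : IsAxiallyPeriodic L U)
    (x : EuclideanSpace ℝ (Fin 3)) (t : ℝ) :
    ∫ s in (0 : ℝ)..L, U (x + t • eZ + s • eZ) = ∫ s in (0 : ℝ)..L, U (x + s • eZ) := by
  have : (fun s : ℝ => U (x + t • eZ + s • eZ)) = fun s : ℝ => U (x + (t + s) • eZ) := by
    funext s; rw [add_smul, add_assoc]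
  rw [this, verticalIntegral_shift hper x t]

/-- **The vertical period integral of a helically symmetric periodic field is axisymmetric**:
`∫₀ᴸ U(R_θ x + s e₃) ds = R_θ ∫₀ᴸ U(x + s e₃) ds`. -/
theorem verticalIntegral_rotZ {κ L : ℝ} {U : EuclideanSpace ℝ (Fin 3) → EuclideanSpace ℝ (Fin 3)}
    (hUc : Continuous U) (hper : IsAxiallyPeriodic L U) (hsym : IsHelicallySymmetric κ U)
    (θ : ℝ) (x : EuclideanSpace ℝ (Fin 3)) :
    ∫ s in (0 : ℝ)..L, U (rotZ θ x + s • eZ) = rotZ θ (∫ s in (0 : ℝ)..L, U (x + s • eZ)) := by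
  have h1 : (fun s : ℝ => U (rotZ θ x + s • eZ)) =
      fun s : ℝ => rotZL θ (U (x + (-(κ * θ) + s) • eZ)) := by
    funext s
    rw [apply_rotZ_add_smul_eZ_of_isHelicallySymmetric hsym, rotZL_apply,
      show s - κ * θ = -(κ * θ) + s by ring]
  have hint : IntervalIntegrable (fun s : ℝ => U (x + (-(κ * θ) + s) • eZ)) volume 0 L :=
    (hUc.comp (continuous_const.add ((continuous_const.add continuous_id).smul
      continuous_const))).intervalIntegrable _ _
  rw [h1, (rotZL θ).intervalIntegral_comp_comm hint, rotZL_apply, verticalIntegral_shift hper x]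

/-- On the axis the vertical period integral is an axial vector: its horizontal part vanishes. -/
theorem horizPart_verticalIntegral_eq_zero_of_horizPart_eq_zero {κ L : ℝ}
    {U : EuclideanSpace ℝ (Fin 3) → EuclideanSpace ℝ (Fin 3)}
    (hUc : Continuous U) (hper : IsAxiallyPeriodic L U) (hsym : IsHelicallySymmetric κ U)
    {x : EuclideanSpace ℝ (Fin 3)} (hx : horizPart x = 0) :
    horizPart (∫ s in (0 : ℝ)..L, U (x + s • eZ)) = 0 := by
  set v : EuclideanSpace ℝ (Fin 3) := ∫ s in (0 : ℝ)..L, U (x + s • eZ) with hv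
  have hx0 : x 0 = 0 := by simpa using congrArg (fun w : EuclideanSpace ℝ (Fin 3) => w 0) hx
  have hx1 : x 1 = 0 := by simpa using congrArg (fun w : EuclideanSpace ℝ (Fin 3) => w 1) hx
  have hfix : rotZ Real.pi x = x := by
    ext i
    fin_cases i <;> simp [rotZ, hx0, hx1]
  have hrot : rotZ Real.pi v = v := by
    have h := verticalIntegral_rotZ hUc hper hsym Real.pi x
    rw [hfix] at h
    exact h.symm
  have hv0 : v 0 = 0 := by
    have h0 := congrArg (fun w : EuclideanSpace ℝ (Fin 3) => w 0) hrot
    simp only [rotZ_apply_zero, Real.cos_pi, Real.sin_pi] at h0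
    linarith
  have hv1 : v 1 = 0 := by
    have h1 := congrArg (fun w : EuclideanSpace ℝ (Fin 3) => w 1) hrot
    simp only [rotZ_apply_one, Real.cos_pi, Real.sin_pi] at h1
    linarith
  rw [horizPart_eq_toLp]
  ext i
  fin_cases i <;> simp [hv0, hv1]

/-- **Differentiation under the vertical period integral.** For `U ∈ C¹` with `‖DU‖ ≤ K`,
`x ↦ ∫₀ᴸ U(x + s e₃) ds` has derivative `∫₀ᴸ DU(x + s e₃) ds` at every point. -/
theorem hasFDerivAt_verticalIntegral {F : Type*} [NormedAddCommGroup F] [NormedSpace ℝ F]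
    [CompleteSpace F] {L : ℝ}
    {U : EuclideanSpace ℝ (Fin 3) → F} (hU : ContDiff ℝ 1 U) {K : ℝ}
    (hK : ∀ x, ‖fderiv ℝ U x‖ ≤ K) (x₀ : EuclideanSpace ℝ (Fin 3)) :
    HasFDerivAt (fun y => ∫ s in (0 : ℝ)..L, U (y + s • eZ))
      (∫ s in (0 : ℝ)..L, fderiv ℝ U (x₀ + s • eZ)) x₀ := by
  have hUd : Differentiable ℝ U := hU.differentiable one_ne_zero
  have hUc : Continuous U := hU.continuous
  have hDUc : Continuous (fderiv ℝ U) := hU.continuous_fderiv one_ne_zero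
  have hline : ∀ y : EuclideanSpace ℝ (Fin 3), Continuous fun s : ℝ => y + s • (eZ : EuclideanSpace ℝ (Fin 3)) :=
    fun y => continuous_const.add (continuous_id.smul continuous_const)
  refine intervalIntegral.hasFDerivAt_integral_of_dominated_of_fderiv_le (𝕜 := ℝ) (μ := volume)
    (F := fun y s => U (y + s • eZ)) (F' := fun y s => fderiv ℝ U (y + s • eZ)) (x₀ := x₀)
    (s := univ) (bound := fun _ => K) univ_mem ?_ ?_ ?_ ?_ ?_ ?_
  · exact Eventually.of_forall fun y => ((hUc.comp (hline y)).aestronglyMeasurable)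
  · exact (hUc.comp (hline x₀)).intervalIntegrable _ _
  · exact (hDUc.comp (hline x₀)).aestronglyMeasurable
  · exact Eventually.of_forall fun s _ y _ => hK _
  · exact intervalIntegrable_const
  · exact Eventually.of_forall fun s _ y _ => by
      have h := (hUd (y + s • eZ)).hasFDerivAt.comp y ((hasFDerivAt_id y).add_const (s • eZ))
      simpa [Function.comp_def] using h

/-! ### The radial flux of the averaged field -/

/-- **The helical flux lemma** (Han–Wang–Xie, §3, (A117)–(A118), Cartesian form). Let
`U ∈ C¹(ℝ³; ℝ³)` have bounded derivative, be divergence free, axially `L`-periodic and helically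
symmetric of pitch `κ` (`IsHelicallySymmetric κ U`). Then the radial velocity `r u^r = ⟪x_h, U⟫`
has zero mean over every vertical period: `∫₀ᴸ ⟪x_h, U(x + s e₃)⟫ ds = 0` for all `x`. -/
theorem helical_radial_verticalMean_eq_zero {κ L : ℝ}
    {U : EuclideanSpace ℝ (Fin 3) → EuclideanSpace ℝ (Fin 3)} (hU : ContDiff ℝ 1 U) {K : ℝ}
    (hK : ∀ x, ‖fderiv ℝ U x‖ ≤ K) (hdiv : VectorCalculus.IsDivFree U)
    (hper : IsAxiallyPeriodic L U) (hsym : IsHelicallySymmetric κ U)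
    (x : EuclideanSpace ℝ (Fin 3)) :
    ∫ s in (0 : ℝ)..L, ⟪horizPart x, U (x + s • eZ)⟫ = 0 := by
  have hUc : Continuous U := hU.continuous
  have hDUc : Continuous (fderiv ℝ U) := hU.continuous_fderiv one_ne_zero
  have hline : ∀ y : EuclideanSpace ℝ (Fin 3), Continuous fun s : ℝ => y + s • (eZ : EuclideanSpace ℝ (Fin 3)) :=
    fun y => continuous_const.add (continuous_id.smul continuous_const)
  -- the averaged field and its derivative
  set g : EuclideanSpace ℝ (Fin 3) → EuclideanSpace ℝ (Fin 3) := fun y => ∫ s in (0 : ℝ)..L, U (y + s • eZ)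
    with hg
  set Dg : EuclideanSpace ℝ (Fin 3) → (EuclideanSpace ℝ (Fin 3) →L[ℝ] EuclideanSpace ℝ (Fin 3)) :=
    fun y => ∫ s in (0 : ℝ)..L, fderiv ℝ U (y + s • eZ) with hDg
  have hgD : ∀ y, HasFDerivAt g (Dg y) y := fun y => hasFDerivAt_verticalIntegral hU hK y
  have hgd : Differentiable ℝ g := fun y => (hgD y).differentiableAt
  have hgF : ∀ y, fderiv ℝ g y = Dg y := fun y => (hgD y).fderiv
  have hDint : ∀ y, IntervalIntegrable (fun s : ℝ => fderiv ℝ U (y + s • eZ)) volume 0 L :=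
    fun y => (hDUc.comp (hline y)).intervalIntegrable _ _
  have hDg_apply : ∀ y v, Dg y v = ∫ s in (0 : ℝ)..L, fderiv ℝ U (y + s • eZ) v := fun y v => by
    rw [hDg]
    exact ContinuousLinearMap.intervalIntegral_apply (hDint y) v
  -- (1) `g` is axisymmetric, (2) invariant under axial translations
  have hgsym : IsAxisymmetric g := fun θ y => verticalIntegral_rotZ hUc hper hsym θ y
  have hgz : ∀ (y : EuclideanSpace ℝ (Fin 3)) (t : ℝ), g (y + t • eZ) = g y :=
    fun y t => verticalIntegral_add_smul_eZ hper y t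
  -- (3) `div g = 0`
  set τ : (EuclideanSpace ℝ (Fin 3) →L[ℝ] EuclideanSpace ℝ (Fin 3)) →L[ℝ] ℝ :=
    LinearMap.toContinuousLinearMap
      ((LinearMap.trace ℝ (EuclideanSpace ℝ (Fin 3))).comp (ContinuousLinearMap.coeLM ℝ)) with hτ
  have hτ_apply : ∀ T : EuclideanSpace ℝ (Fin 3) →L[ℝ] EuclideanSpace ℝ (Fin 3),
      τ T = LinearMap.trace ℝ _ (T : EuclideanSpace ℝ (Fin 3) →ₗ[ℝ] EuclideanSpace ℝ (Fin 3)) :=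
    fun T => rfl
  have hdivg : ∀ y, VectorCalculus.divergence g y = 0 := fun y => by
    rw [VectorCalculus.divergence, hgF y, ← hτ_apply, hDg, ← τ.intervalIntegral_comp_comm (hDint y)]
    have : (fun s : ℝ => τ (fderiv ℝ U (y + s • eZ))) = fun _ => (0 : ℝ) := by
      funext s
      rw [hτ_apply]
      exact hdiv (y + s • eZ)
    rw [this, intervalIntegral.integral_const, smul_zero]
  -- (4) `Dg(y) e₃ = 0`
  have hDg_eZ : ∀ y, fderiv ℝ g y eZ = 0 := fun y => by
    have h1 : HasDerivAt (fun t : ℝ => g (y + t • eZ)) (fderiv ℝ g (y + (0 : ℝ) • eZ) eZ) 0 :=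
      hasDerivAt_comp_add_smul_eZ hgd y 0
    have h2 : (fun t : ℝ => g (y + t • eZ)) = fun _ => g y := funext fun t => hgz y t
    rw [h2, zero_smul, add_zero] at h1
    exact h1.unique (hasDerivAt_const (0 : ℝ) (g y))
  -- (5) infinitesimal axisymmetry `Dg(y)[J y] = J g(y)`
  have hDg_rot : ∀ y, fderiv ℝ g y (rotGen y) = rotGen (g y) := fun y => hgsym.fderiv_rotGen (hgd y)
  -- (6) the key identity `⟪Dg(y) y_h, y_h⟫ + ⟪y_h, g y⟫ = 0`
  set b := EuclideanSpace.basisFun (Fin 3) ℝ with hb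
  have key : ∀ y : EuclideanSpace ℝ (Fin 3),
      ⟪fderiv ℝ g y (horizPart y), horizPart y⟫ + ⟪horizPart y, g y⟫ = 0 := by
    intro y
    set G := fderiv ℝ g y with hG
    -- entries of `G` in the standard basis
    have hb0 : b 0 = EuclideanSpace.single 0 (1 : ℝ) := by simp [hb]
    have hb1 : b 1 = EuclideanSpace.single 1 (1 : ℝ) := by simp [hb]
    have hb2 : b 2 = EuclideanSpace.single 2 (1 : ℝ) := by simp [hb]
    -- trace
    have htr : ⟪b 0, G (b 0)⟫ + ⟪b 1, G (b 1)⟫ + ⟪b 2, G (b 2)⟫ = 0 := by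
      have h := divergence_eq_sum_inner_fderiv b g y
      rw [hdivg y, Fin.sum_univ_three] at h
      rw [hG]; linarith
    have htr' : G (b 0) 0 + G (b 1) 1 + G (b 2) 2 = 0 := by
      have h := htr
      rw [hb0, hb1, hb2] at h ⊢
      simpa [EuclideanSpace.inner_single_left] using h
    -- axial column vanishes
    have hcol : G (b 2) = 0 := by rw [hb2, hG]; exact hDg_eZ y
    have hG22 : G (b 2) 2 = 0 := by rw [hcol]; rfl
    -- infinitesimal axisymmetry in coordinates
    have hrot := hDg_rot y
    rw [← hG, rotGen_eq_sub_single, map_sub, map_smul, map_smul, ← hb0, ← hb1] at hrot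
    have hr0 := congrArg (fun w : EuclideanSpace ℝ (Fin 3) => w 0) hrot
    have hr1 := congrArg (fun w : EuclideanSpace ℝ (Fin 3) => w 1) hrot
    simp only [PiLp.sub_apply, PiLp.smul_apply, smul_eq_mul, rotGen_apply_zero, rotGen_apply_one] at hr0 hr1
    -- expand the goal in coordinates
    have hhp : horizPart y = y 0 • b 0 + y 1 • b 1 := by
      rw [horizPart_eq_toLp, hb0, hb1]; ext i; fin_cases i <;> simp
    have e1 : ⟪G (horizPart y), horizPart y⟫ =
        y 0 * (y 0 * G (b 0) 0 + y 1 * G (b 1) 0) + y 1 * (y 0 * G (b 0) 1 + y 1 * G (b 1) 1) := by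
      rw [real_inner_comm, inner_horizPart_left, hhp, map_add, map_smul, map_smul]
      simp only [PiLp.add_apply, PiLp.smul_apply, smul_eq_mul]
    have e2 : ⟪horizPart y, g y⟫ = y 0 * g y 0 + y 1 * g y 1 := inner_horizPart_left y (g y)
    rw [e1, e2]
    linear_combination (y 0 ^ 2 + y 1 ^ 2) * htr' - (y 0 ^ 2 + y 1 ^ 2) * hG22 +
      y 1 * hr0 - y 0 * hr1
  -- (7) the flux function `h(y) = ⟪y_h, g y⟫` is constant along horizontal rays
  set h : EuclideanSpace ℝ (Fin 3) → ℝ := fun y => ⟪horizPart y, g y⟫ with hh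
  have hhd : ∀ y, HasFDerivAt h ((innerSL ℝ (horizPart y)).comp (fderiv ℝ g y) +
      (innerSL ℝ (g y)).comp horizPart) y := by
    intro y
    refine ((horizPart.hasFDerivAt (x := y)).inner ℝ (hgd y).hasFDerivAt).congr_fderiv ?_
    ext v
    simp only [_root_.add_apply, ContinuousLinearMap.comp_apply, innerSL_apply_apply,
      fderivInnerCLM_apply, ContinuousLinearMap.prod_apply]
    rw [real_inner_comm (g y)]
  have hhD : ∀ y v, fderiv ℝ h y v = ⟪horizPart y, fderiv ℝ g y v⟫ + ⟪g y, horizPart v⟫ := by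
    intro y v
    rw [(hhd y).fderiv]
    simp only [_root_.add_apply, ContinuousLinearMap.comp_apply, innerSL_apply_apply]
  -- along the ray `t ↦ c + t x_h` with `c = x₂ e₃` on the axis
  set c : EuclideanSpace ℝ (Fin 3) := (x 2) • eZ with hc
  have hc0 : horizPart c = 0 := by
    rw [hc, map_smul, horizPart_eZ, smul_zero]
  have hray : ∀ t : ℝ, horizPart (c + t • horizPart x) = t • horizPart x := by
    intro t; rw [map_add, hc0, zero_add, map_smul, horizPart_horizPart]
  set ψ : ℝ → ℝ := fun t => h (c + t • horizPart x) with hψ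
  have hψd : ∀ t, HasDerivAt ψ (fderiv ℝ h (c + t • horizPart x) (horizPart x)) t := by
    intro t
    have hl : HasDerivAt (fun τ : ℝ => c + τ • horizPart x) (horizPart x) t := by
      have := ((hasDerivAt_id t).smul_const (horizPart x)).const_add c
      simpa using this
    exact ((hhd _).comp_hasDerivAt t hl).congr_deriv (by rw [(hhd _).fderiv])
  have hψ0 : ∀ t : ℝ, fderiv ℝ h (c + t • horizPart x) (horizPart x) = 0 := by
    intro t
    set y := c + t • horizPart x with hy
    have hyh : horizPart y = t • horizPart x := hray t
    rcases eq_or_ne t 0 with ht | ht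
    · -- on the axis: `g` is axial, `Dh(c)[x_h] = ⟪g c, x_h⟫ = 0`
      have hyc : y = c := by rw [hy, ht, zero_smul, add_zero]
      have hgc : horizPart (g c) = 0 :=
        horizPart_verticalIntegral_eq_zero_of_horizPart_eq_zero hUc hper hsym hc0
      rw [hhD, hyh, ht, zero_smul, inner_zero_left, zero_add, horizPart_horizPart, hyc,
        real_inner_comm, ← inner_horizPart_horizPart, hgc, inner_zero_right]
    · -- off the axis: `t · Dh(y)[x_h] = ⟪Dg y_h, y_h⟫ + ⟪y_h, g⟫ = 0` up to the factor `t`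
      have hk := key y
      rw [hyh] at hk
      simp only [map_smul, real_inner_smul_left, real_inner_smul_right] at hk
      have e3 : ⟪horizPart x, fderiv ℝ g y (horizPart x)⟫ = ⟪fderiv ℝ g y (horizPart x), horizPart x⟫ :=
        real_inner_comm _ _
      have e4 : ⟪g y, horizPart x⟫ = ⟪horizPart x, g y⟫ := real_inner_comm _ _
      rw [hhD, hyh, real_inner_smul_left, horizPart_horizPart, e3, e4]
      have h0 : t * (t * ⟪fderiv ℝ g y (horizPart x), horizPart x⟫ + ⟪horizPart x, g y⟫) = 0 := by
        linear_combination hk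
      rcases mul_eq_zero.1 h0 with h1 | h1
      · exact absurd h1 ht
      · exact h1
  have hψconst : ψ 1 = ψ 0 :=
    is_const_of_deriv_eq_zero (fun t => (hψd t).differentiableAt)
      (fun t => by rw [(hψd t).deriv, hψ0 t]) 1 0
  have hψ0' : ψ 0 = 0 := by
    simp only [hψ, zero_smul, add_zero, hh, hc0, inner_zero_left]
  have hψ1 : ψ 1 = ∫ s in (0 : ℝ)..L, ⟪horizPart x, U (x + s • eZ)⟫ := by
    have hxc : c + (1 : ℝ) • horizPart x = x := by
      rw [one_smul, hc, add_comm]; exact horizPart_add_apply_two_smul_eZ x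
    simp only [hψ, hh, hxc, hg]
    show innerSL ℝ (horizPart x) (∫ s in (0 : ℝ)..L, U (x + s • eZ)) = _
    have hint : IntervalIntegrable (fun s : ℝ => U (x + s • eZ)) volume 0 L :=
      (hUc.comp (hline x)).intervalIntegrable _ _
    rw [← (innerSL ℝ (horizPart x)).intervalIntegral_comp_comm hint]
    simp only [innerSL_apply_apply]
  rw [← hψ1, hψconst, hψ0']

end Summit.NavierStokesRegularity.NavierStokesRegularity.Theorems.ScenarioCensus.HelicalSlab

end
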